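import Summits.Ventures.LatticeQCDFlow.Scoring.U1TorusPlaquetteMomentBounds
import Mathlib.Algebra.Order.Chebyshev
import HarnessLib

/-!
# The 2-d `U(1)` torus: distinct plaquettes are non-negatively correlated, `0 ≤ Cov ≤ 3ρ_V`

HONEST FRAMING: exact (Metropolis-corrected) sampling algorithms for lattice gauge theory;
figures of merit are autocorrelation/cost numbers at stated couplings and volumes; no
continuum-physics claim.

Venture `LatticeQCDFlow` (cell pub-lqcd), sub-topic `Scoring`; FANOUT row 5 (`s0-sun-a`), GEN-13.
NEW WORK of the cell (placement rule).  `Scoring/U1TorusPlaquettePair.lean` (GEN-13) gives the exact pair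
correlation `⟨cos θ_x cos θ_y⟩_{L₁×L₂,β} = P/Z` of two distinct plaquettes and
`Scoring/U1TorusCharacterFormula.lean` (GEN-7) the plaquette `⟨cos θ_x⟩ = N/Z`, with
`Z = Σ_k a_k^V`, `N = Σ_k a_k^{V−1}J_k`, `P = Σ_k a_k^{V−2}J_k²` (`a_k = I_{|k|}(β)`, `J_k = (a_{k−1}+a_{k+1})/2`).
For `β > 0` and `V = W + 3 ≥ 3`, writing the covariance `Cov = P/Z − (N/Z)²` of any two distinct
plaquettes (it does not depend on the pair) and `ρ_V = T/A − 1 = Σ_{k≠0}(a_k/a_0)^{V−2}`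
(`T = Σ_k a_k^{V−2}`, `A = a_0^{V−2}`):

* `torusN_sq_le_torusP_mul_torusZ` — `N² ≤ P·Z` (weighted Cauchy–Schwarz, finite sums then `tsum`);
* **`torusCov_nonneg`** — `0 ≤ Cov`: on the 2-d `U(1)` torus any two distinct plaquettes are
  NON-NEGATIVELY correlated, at every volume and every `β > 0`;
* **`torusCov_le`** — `Cov ≤ 3ρ_V` (`P/Z ≤ t² + ρ_V`, `N/Z ≥ t/(1 + ρ_V)`, `t = a_1/a_0 ≤ 1`): the
  correlation is exponentially small in the volume (`ρ_V ≤ t^{V−3}(e^β − 1)`, companion file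
  `Scoring/U1TorusPlaquetteVarianceFiniteVolume.lean`).

Elementary; nothing is cited; no `def`.
-/

noncomputable section

open Real Finset
open scoped Nat
open Literature.Analysis.FunctionSpaces

namespace Summit.Ventures.LatticeQCDFlow.Scoring

/-! ### 1. The pair covariance: `0 ≤ P/Z − (N/Z)² ≤ 3ρ` -/

/-- **Weighted Cauchy–Schwarz for the torus sums**: `N² ≤ P·Z` (`V = W + 3`). -/
theorem torusN_sq_le_torusP_mul_torusZ {β : ℝ} (hβ : 0 < β) (W : ℕ) :
    (∑' k : ℤ, besselI k.natAbs β ^ (W + 2) *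
        ((besselI (k - 1).natAbs β + besselI (k + 1).natAbs β) / 2)) ^ 2 ≤
      (∑' k : ℤ, besselI k.natAbs β ^ (W + 1) *
          ((besselI (k - 1).natAbs β + besselI (k + 1).natAbs β) / 2) ^ 2) *
        ∑' k : ℤ, besselI k.natAbs β ^ (W + 3) := by
  set a : ℤ → ℝ := fun k => besselI k.natAbs β with ha
  set J : ℤ → ℝ := fun k => (besselI (k - 1).natAbs β + besselI (k + 1).natAbs β) / 2 with hJ
  have ha0 : ∀ k, 0 < a k := fun k => besselI_pos _ hβ
  have hJ0 : ∀ k, 0 ≤ J k := fun k => (torusJ_mem hβ k).1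
  have hNs : Summable fun k : ℤ => a k ^ (W + 2) * J k := summable_torusN_term hβ (V := W + 3) (by omega)
  have hPs : Summable fun k : ℤ => a k ^ (W + 1) * J k ^ 2 :=
    summable_torusP_term hβ (V := W + 3) (by omega)
  have hZs : Summable fun k : ℤ => a k ^ (W + 3) := summable_besselI_natAbs_pow hβ (by omega)
  show (∑' k : ℤ, a k ^ (W + 2) * J k) ^ 2 ≤ (∑' k : ℤ, a k ^ (W + 1) * J k ^ 2) * ∑' k : ℤ, a k ^ (W + 3)
  -- finite Cauchy–Schwarz, then pass to the limit
  have hfin : ∀ F : Finset ℤ, (∑ k ∈ F, a k ^ (W + 2) * J k) ^ 2 ≤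
      (∑' k : ℤ, a k ^ (W + 1) * J k ^ 2) * ∑' k : ℤ, a k ^ (W + 3) := fun F => by
    have hcs := Finset.sum_mul_sq_le_sq_mul_sq F (fun k => Real.sqrt (a k ^ (W + 1)) * J k)
      (fun k => Real.sqrt (a k ^ (W + 1)) * a k)
    have hsq : ∀ k, Real.sqrt (a k ^ (W + 1)) * Real.sqrt (a k ^ (W + 1)) = a k ^ (W + 1) := fun k =>
      Real.mul_self_sqrt (pow_nonneg (ha0 k).le _)
    have e1 : ∀ k, Real.sqrt (a k ^ (W + 1)) * J k * (Real.sqrt (a k ^ (W + 1)) * a k) =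
        a k ^ (W + 2) * J k := fun k => by
      rw [show Real.sqrt (a k ^ (W + 1)) * J k * (Real.sqrt (a k ^ (W + 1)) * a k) =
        (Real.sqrt (a k ^ (W + 1)) * Real.sqrt (a k ^ (W + 1))) * a k * J k by ring, hsq]
      ring
    have e2 : ∀ k, (Real.sqrt (a k ^ (W + 1)) * J k) ^ 2 = a k ^ (W + 1) * J k ^ 2 := fun k => by
      rw [mul_pow, Real.sq_sqrt (pow_nonneg (ha0 k).le _)]
    have e3 : ∀ k, (Real.sqrt (a k ^ (W + 1)) * a k) ^ 2 = a k ^ (W + 3) := fun k => by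
      rw [mul_pow, Real.sq_sqrt (pow_nonneg (ha0 k).le _)]; ring
    simp only [e1, e2, e3] at hcs
    refine hcs.trans (mul_le_mul ?_ ?_ (Finset.sum_nonneg fun k _ => (pow_pos (ha0 k) _).le)
      (tsum_nonneg fun k => mul_nonneg (pow_nonneg (ha0 k).le _) (sq_nonneg _)))
    · exact hPs.sum_le_tsum F fun k _ => mul_nonneg (pow_nonneg (ha0 k).le _) (sq_nonneg _)
    · exact hZs.sum_le_tsum F fun k _ => (pow_pos (ha0 k) _).le
  have hAB : 0 ≤ (∑' k : ℤ, a k ^ (W + 1) * J k ^ 2) * ∑' k : ℤ, a k ^ (W + 3) :=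
    mul_nonneg (tsum_nonneg fun k => mul_nonneg (pow_nonneg (ha0 k).le _) (sq_nonneg _))
      (tsum_nonneg fun k => (pow_pos (ha0 k) _).le)
  have hC : ∑' k : ℤ, a k ^ (W + 2) * J k ≤
      Real.sqrt ((∑' k : ℤ, a k ^ (W + 1) * J k ^ 2) * ∑' k : ℤ, a k ^ (W + 3)) := by
    refine hNs.tsum_le_of_sum_le fun F => ?_
    rw [← Real.sqrt_sq (Finset.sum_nonneg fun k _ => mul_nonneg (pow_nonneg (ha0 k).le _) (hJ0 k))]
    exact Real.sqrt_le_sqrt (hfin F)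
  have hC0 : 0 ≤ ∑' k : ℤ, a k ^ (W + 2) * J k :=
    tsum_nonneg fun k => mul_nonneg (pow_nonneg (ha0 k).le _) (hJ0 k)
  calc (∑' k : ℤ, a k ^ (W + 2) * J k) ^ 2
      ≤ Real.sqrt ((∑' k : ℤ, a k ^ (W + 1) * J k ^ 2) * ∑' k : ℤ, a k ^ (W + 3)) ^ 2 :=
        pow_le_pow_left₀ hC0 hC 2
    _ = _ := Real.sq_sqrt hAB

/-- **Distinct plaquettes are non-negatively correlated**: `0 ≤ P/Z − (N/Z)²` (`V = W + 3`). -/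
theorem torusCov_nonneg {β : ℝ} (hβ : 0 < β) (W : ℕ) :
    0 ≤ (∑' k : ℤ, besselI k.natAbs β ^ (W + 1) *
          ((besselI (k - 1).natAbs β + besselI (k + 1).natAbs β) / 2) ^ 2) /
        (∑' k : ℤ, besselI k.natAbs β ^ (W + 3)) -
      ((∑' k : ℤ, besselI k.natAbs β ^ (W + 2) *
          ((besselI (k - 1).natAbs β + besselI (k + 1).natAbs β) / 2)) /
        ∑' k : ℤ, besselI k.natAbs β ^ (W + 3)) ^ 2 := by
  have hcs := torusN_sq_le_torusP_mul_torusZ hβ W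
  have hZ : 0 < ∑' k : ℤ, besselI k.natAbs β ^ (W + 3) :=
    (summable_besselI_natAbs_pow hβ (by omega)).tsum_pos
      (fun k => (pow_pos (besselI_pos _ hβ) _).le) 0 (pow_pos (besselI_pos _ hβ) _)
  rw [div_pow, sub_nonneg, div_le_div_iff₀ (pow_pos hZ 2) hZ]
  nlinarith

/-- Splitting off the charge `k = 0`: `Σ_k f_k = f_0 + Σ_{k} [k ≠ 0] f_k`, and the sum over `k ≠ 0` of
`a_k^{W+1} g_k` with `0 ≤ g_k ≤ C` is at most `C · Σ_{k≠0} a_k^{W+1}`. -/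
theorem tsum_ite_weight_le {β : ℝ} (hβ : 0 < β) (W : ℕ) {g : ℤ → ℝ} {C : ℝ}
    (hg0 : ∀ k, 0 ≤ g k) (hgC : ∀ k, g k ≤ C)
    (hs : Summable fun k : ℤ => besselI k.natAbs β ^ (W + 1) * g k) :
    ∑' k : ℤ, (if k = 0 then 0 else besselI k.natAbs β ^ (W + 1) * g k) ≤
      C * ∑' k : ℤ, (if k = 0 then 0 else besselI k.natAbs β ^ (W + 1)) := by
  have hs0 : Summable fun k : ℤ => besselI k.natAbs β ^ (W + 1) :=
    summable_besselI_natAbs_pow hβ (by omega)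
  have h1 : Summable fun k : ℤ => (if k = 0 then 0 else besselI k.natAbs β ^ (W + 1) * g k) := by
    refine Summable.of_nonneg_of_le (fun k => ?_) (fun k => ?_) hs
    · split_ifs
      · exact le_rfl
      · exact mul_nonneg (pow_nonneg (besselI_pos _ hβ).le _) (hg0 k)
    · split_ifs
      · exact mul_nonneg (pow_nonneg (besselI_pos _ hβ).le _) (hg0 k)
      · exact le_rfl
  have hite : Summable fun k : ℤ => (if k = 0 then 0 else besselI k.natAbs β ^ (W + 1)) := by
    refine Summable.of_nonneg_of_le (fun k => ?_) (fun k => ?_) hs0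
    · split_ifs
      · exact le_rfl
      · exact pow_nonneg (besselI_pos _ hβ).le _
    · split_ifs
      · exact pow_nonneg (besselI_pos _ hβ).le _
      · exact le_rfl
  have h2 : Summable fun k : ℤ => C * (if k = 0 then 0 else besselI k.natAbs β ^ (W + 1)) :=
    hite.mul_left C
  rw [← tsum_mul_left]
  refine h1.tsum_le_tsum (fun k => ?_) h2
  split_ifs
  · simp
  · rw [mul_comm C]
    exact mul_le_mul_of_nonneg_left (hgC k) (pow_nonneg (besselI_pos _ hβ).le _)

/-- **The pair covariance decays with the volume**: with `A = a_0^{W+1}`, `T = Σ_k a_k^{W+1}`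
(`a_k = I_{|k|}(β)`, `V = W + 3`): `P/Z − (N/Z)² ≤ 3 (T/A − 1)`. -/
theorem torusCov_le {β : ℝ} (hβ : 0 < β) (W : ℕ) :
    (∑' k : ℤ, besselI k.natAbs β ^ (W + 1) *
          ((besselI (k - 1).natAbs β + besselI (k + 1).natAbs β) / 2) ^ 2) /
        (∑' k : ℤ, besselI k.natAbs β ^ (W + 3)) -
      ((∑' k : ℤ, besselI k.natAbs β ^ (W + 2) *
          ((besselI (k - 1).natAbs β + besselI (k + 1).natAbs β) / 2)) /
        ∑' k : ℤ, besselI k.natAbs β ^ (W + 3)) ^ 2 ≤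
      3 * ((∑' k : ℤ, besselI k.natAbs β ^ (W + 1)) / besselI 0 β ^ (W + 1) - 1) := by
  set a : ℤ → ℝ := fun k => besselI k.natAbs β with ha
  set J : ℤ → ℝ := fun k => (besselI (k - 1).natAbs β + besselI (k + 1).natAbs β) / 2 with hJ
  have ha0 : ∀ k, 0 < a k := fun k => besselI_pos _ hβ
  have haI : ∀ k, a k ≤ besselI 0 β := fun k => besselI_le_besselI_zero _ β
  have hJ0 : ∀ k, 0 ≤ J k := fun k => (torusJ_mem hβ k).1
  have hJI : ∀ k, J k ≤ besselI 0 β := fun k => (torusJ_mem hβ k).2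
  have hI0 : 0 < besselI 0 β := besselI_pos 0 hβ
  have hI1 : 0 < besselI 1 β := besselI_pos 1 hβ
  have ht1 : besselI 1 β ≤ besselI 0 β := besselI_le_besselI_zero 1 β
  have hNs : Summable fun k : ℤ => a k ^ (W + 2) * J k := summable_torusN_term hβ (V := W + 3) (by omega)
  have hPs : Summable fun k : ℤ => a k ^ (W + 1) * J k ^ 2 :=
    summable_torusP_term hβ (V := W + 3) (by omega)
  have hZs : Summable fun k : ℤ => a k ^ (W + 3) := summable_besselI_natAbs_pow hβ (by omega)
  have hTs : Summable fun k : ℤ => a k ^ (W + 1) := summable_besselI_natAbs_pow hβ (by omega)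
  show (∑' k : ℤ, a k ^ (W + 1) * J k ^ 2) / (∑' k : ℤ, a k ^ (W + 3)) -
      ((∑' k : ℤ, a k ^ (W + 2) * J k) / ∑' k : ℤ, a k ^ (W + 3)) ^ 2 ≤
    3 * ((∑' k : ℤ, a k ^ (W + 1)) / besselI 0 β ^ (W + 1) - 1)
  set A := besselI 0 β ^ (W + 1) with hA
  set T := ∑' k : ℤ, a k ^ (W + 1) with hT
  set Z := ∑' k : ℤ, a k ^ (W + 3) with hZdef
  set N := ∑' k : ℤ, a k ^ (W + 2) * J k with hNdef
  set P := ∑' k : ℤ, a k ^ (W + 1) * J k ^ 2 with hPdef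
  have hA0 : 0 < A := pow_pos hI0 _
  have ha00 : a 0 = besselI 0 β := by simp [ha]
  have hJ00 : J 0 = besselI 1 β := by simp [hJ]
  -- the `k ≠ 0` mass `T − A`
  have hTsplit : T = A + ∑' k : ℤ, (if k = 0 then 0 else a k ^ (W + 1)) := by
    rw [hT, hTs.tsum_eq_add_tsum_ite 0, ha00]
  have hρ0 : 0 ≤ T - A := by
    rw [hTsplit, add_sub_cancel_left]
    exact tsum_nonneg fun k => by split_ifs <;> [exact le_rfl; exact pow_nonneg (ha0 k).le _]
  -- `Z ≥ a_0² A`, `Z ≤ a_0² T`, `N ≥ a_0 A a_1`, `P ≤ A a_1² + a_0²(T − A)`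
  have hZlo : besselI 0 β ^ 2 * A ≤ Z := by
    have h := hZs.le_tsum 0 fun k _ => (pow_pos (ha0 k) _).le
    rw [ha00] at h
    calc besselI 0 β ^ 2 * A = besselI 0 β ^ (W + 3) := by rw [hA]; ring
      _ ≤ Z := h
  have hZhi : Z ≤ besselI 0 β ^ 2 * T := by
    rw [hT, ← tsum_mul_left]
    refine hZs.tsum_le_tsum (fun k => ?_) (hTs.mul_left _)
    calc a k ^ (W + 3) = a k ^ 2 * a k ^ (W + 1) := by ring
      _ ≤ besselI 0 β ^ 2 * a k ^ (W + 1) :=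
          mul_le_mul_of_nonneg_right (pow_le_pow_left₀ (ha0 k).le (haI k) 2) (pow_nonneg (ha0 k).le _)
  have hNlo : besselI 0 β * A * besselI 1 β ≤ N := by
    have h := hNs.le_tsum 0 fun k _ => mul_nonneg (pow_nonneg (ha0 k).le _) (hJ0 k)
    rw [ha00, hJ00] at h
    calc besselI 0 β * A * besselI 1 β = besselI 0 β ^ (W + 2) * besselI 1 β := by rw [hA]; ring
      _ ≤ N := h
  have hPhi : P ≤ A * besselI 1 β ^ 2 + besselI 0 β ^ 2 * (T - A) := by
    rw [hPdef, hPs.tsum_eq_add_tsum_ite 0, ha00, hJ00, hTsplit, add_sub_cancel_left]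
    refine add_le_add le_rfl ?_
    have h := tsum_ite_weight_le hβ W (g := fun k => J k ^ 2) (C := besselI 0 β ^ 2)
      (fun k => sq_nonneg _) (fun k => pow_le_pow_left₀ (hJ0 k) (hJI k) 2) hPs
    exact h
  -- combine
  have hZ0 : 0 < Z := lt_of_lt_of_le (by positivity) hZlo
  have hT0 : 0 < T := lt_of_lt_of_le hA0 (by linarith)
  have ht : besselI 1 β / besselI 0 β ≤ 1 := (div_le_one hI0).mpr ht1
  have ht0 : 0 ≤ besselI 1 β / besselI 0 β := div_nonneg hI1.le hI0.le
  -- `P/Z ≤ t² + ρ`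
  have h1 : P / Z ≤ (besselI 1 β / besselI 0 β) ^ 2 + (T / A - 1) := by
    rw [div_le_iff₀ hZ0]
    have e : ((besselI 1 β / besselI 0 β) ^ 2 + (T / A - 1)) * Z =
        (besselI 1 β ^ 2 / besselI 0 β ^ 2) * Z + ((T - A) / A) * Z := by
      field_simp
    rw [e]
    have k1 : A * besselI 1 β ^ 2 ≤ besselI 1 β ^ 2 / besselI 0 β ^ 2 * Z := by
      rw [div_mul_eq_mul_div, le_div_iff₀ (pow_pos hI0 2)]
      nlinarith [hZlo, sq_nonneg (besselI 1 β)]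
    have k2 : besselI 0 β ^ 2 * (T - A) ≤ (T - A) / A * Z := by
      rw [div_mul_eq_mul_div, le_div_iff₀ hA0]
      nlinarith [hZlo, hρ0]
    linarith
  -- `N/Z ≥ t·A/T`, so `(N/Z)² ≥ t²(1 − 2ρ)`
  have h2 : besselI 1 β / besselI 0 β * (A / T) ≤ N / Z := by
    rw [le_div_iff₀ hZ0, div_mul_div_comm, div_mul_eq_mul_div, div_le_iff₀ (mul_pos hI0 hT0)]
    calc besselI 1 β * A * Z ≤ besselI 1 β * A * (besselI 0 β ^ 2 * T) :=
          mul_le_mul_of_nonneg_left hZhi (by positivity)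
      _ = besselI 0 β * A * besselI 1 β * (besselI 0 β * T) := by ring
      _ ≤ N * (besselI 0 β * T) := mul_le_mul_of_nonneg_right hNlo (by positivity)
  have hρ : 0 ≤ T / A - 1 := by rw [sub_nonneg, le_div_iff₀ hA0]; linarith
  have hρeq : T / A - 1 = (T - A) / A := by field_simp
  have h3 : (besselI 1 β / besselI 0 β) ^ 2 * (1 - 2 * (T / A - 1)) ≤ (N / Z) ^ 2 := by
    have hlow : 0 ≤ besselI 1 β / besselI 0 β * (A / T) := by positivity
    have hsq := pow_le_pow_left₀ hlow h2 2
    refine le_trans ?_ hsq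
    rw [mul_pow]
    refine mul_le_mul_of_nonneg_left ?_ (sq_nonneg _)
    rw [hρeq, show 1 - 2 * ((T - A) / A) = (A - 2 * (T - A)) / A by field_simp, div_pow,
      div_le_div_iff₀ hA0 (pow_pos hT0 2)]
    have hD := hρ0
    nlinarith [mul_nonneg hA0.le (sq_nonneg (T - A)), pow_nonneg hD 3, mul_nonneg hA0.le hD]
  have ht2 : (besselI 1 β / besselI 0 β) ^ 2 ≤ 1 := pow_le_one₀ ht0 ht
  have h4 : (besselI 1 β / besselI 0 β) ^ 2 * (T / A - 1) ≤ T / A - 1 :=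
    mul_le_of_le_one_left hρ ht2
  nlinarith [h1, h3, h4]

end Summit.Ventures.LatticeQCDFlow.Scoring
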